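import Summits.QuantumFields.YangMills.Theorems.TwistedTraceScaling.Negative.ModelPerturbedNearRigidity
import HarnessLib

/-!
# R21b (crux `TwistedTraceScaling`, stmt-QuantumFields-20203; C4 INNER, brick O′ p605943): the REGIONAL form of the relative-closeness hypothesis —
# its `η` has a FIRST-ORDER FLOOR in the stiff-data change on any stiff ball, and is ACHIEVABLE at first order (so the re-typed O′ is viable, and its
# box-sup is what R21 §2 kills)

Sequel to R21 (`…Negative.ModelPerturbedNearRigidity`: the GLOBAL `hnear` of `…InnerModelPerturbed` admits no slow-dependent stiff data at all).  The repair R21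
asks for is a REGIONAL hypothesis `hnear_S : ∀ x x', x.2 ∈ S → x'.2 ∈ S → |K₂ x x' − 1·(k⊗K^{a,b}) x x'| ≤ η·1·(k⊗K^{a,b}) x x'` on a stiff region `S ⊂ ℝ^σ` (plus an
absolute tail off `S`, not modelled here).  For the fibrewise-Mehler kernel `K₂((c,q),(c',q')) = k(c,c')·K^{A(c,c'),B(c,c')}(q,q')` with slow-dependent data this file proves:
* `exp_logRatio_bounds_of_near_on` — on `S`, at every slow pair with `k(c,c') > 0`: `1 − η ≤ exp Q(q,q') ≤ 1 + η`, `Q` the log-ratio quadratic form of R21;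
* ★ `width_floor_of_near_on` — FLOOR: if `t·e_j ∈ S` then `x/(1+x) ≤ η` with `x = 2|a_j − A_j(c,c')|t²` (and `widthSum_floor_of_near_on`: `x = |a_j − A_j + b_j − B_j|t²` if also
  `0 ∈ S`): a first-order change `|A(c,c') − a| ≍ |c|` of one stiff width on a stiff ball of radius `ρ` forces `η ≳ |c|ρ²` — no `η` of second order `|c|²` and no
  `η = O(β^{−1/2}·polylog)` uniformly over slow data with `|A(c) − a| ≫ β^{−1/2}`;
* ★ `near_on_box_of_stiffData_close` — ACHIEVABILITY: if `|a_j − A_j(c,c')| ≤ δ`, `|b_j − B_j(c,c')| ≤ δ` for all slow pairs and coordinates, `k ≥ 0` and `6|σ|δρ² ≤ 1`,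
  then `hnear_S` holds on the stiff box `S = {q : ∀ j, |q_j| ≤ ρ}` with `η = 12·|σ|·δ·ρ²` (FIRST order in `δ`; `abs_logRatio_le_on_box`: `|Q| ≤ 6|σ|δρ²` there).
READING (Disproof.lean VERDICT 17 / regime (10)(a)(c)).  The regional O′ is the right statement and is instantiable, with `η(c,c') ≍ ρ²·max_j(|ΔA_j|, |ΔB_j|)` FIRST order
in the slow data; taking the sup over the slow region that carries the package's test families (`|c| ≲ powScale p β`, `p < 2/51`) gives `η ≳ κβ^{−p}ρ²`, hence O′'s
`b = η·(…)` box-uniform `≥ κ'β^{−p}` — exactly the hypothesis of `R21.offDiag_budget_false_of_first_order` (dead for `p < 1/6`): the slow cut (brick R) is forced, not optional.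
HONEST FRAMING: elementary real analysis about the hypothesis shape of a helper (brick O′) of a stub interface (S-BASE C4) of a child of the CONDITIONAL reduction route
(femto rung R2b1); not `¬TwistedTraceScaling`, not infinite volume, not a gap, not Clay.  Sorry-free, no new definition; axioms ⊆ {propext, Classical.choice, Quot.sound}.

## References
* M. Lüscher, Nucl. Phys. B219 (1983) 233, §3. [Luscher1983]
* B. Helffer, *Spectral Theory and its Applications*, CUP 2013, Lemma 7.1 (Schur's test). [Helffer2013]
-/

set_option autoImplicit false

noncomputable section

open scoped Real BigOperators
open Summit.QuantumFields.YangMills.Theorems.FemtoTransferGap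
open Summit.QuantumFields.YangMills.Theorems.FemtoTransferGap.Mehler

namespace Summit.QuantumFields.YangMills.Theorems.TwistedTraceScaling.Negative.R21

variable {C : Type*} {σ : Type*} [Fintype σ]

/-! ## §1 The regional hypothesis pins the log-ratio on the region -/

/-- On a stiff region `S`: `1 − η ≤ exp Q(q,q') ≤ 1 + η` at every slow pair with `k(c,c') > 0` and all `q, q' ∈ S`. [cite: Helffer2013, Lemma 7.1] -/
theorem exp_logRatio_bounds_of_near_on {k : C → C → ℝ} {a b : σ → ℝ} {A B : C → C → σ → ℝ} {η : ℝ} {S : Set (σ → ℝ)}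
    (hnear : ∀ x x' : C × (σ → ℝ), x.2 ∈ S → x'.2 ∈ S →
      |k x.1 x'.1 * mehlerKernel (A x.1 x'.1) (B x.1 x'.1) x.2 x'.2 - 1 * tensorKernel k a b x x'| ≤ η * 1 * tensorKernel k a b x x')
    {c c' : C} (hk : 0 < k c c') {q q' : σ → ℝ} (hq : q ∈ S) (hq' : q' ∈ S) :
    1 - η ≤ Real.exp (∑ j, ((a j - A c c' j) * (q j ^ 2 + q' j ^ 2) + (b j - B c c' j) * (q j - q' j) ^ 2)) ∧
      Real.exp (∑ j, ((a j - A c c' j) * (q j ^ 2 + q' j ^ 2) + (b j - B c c' j) * (q j - q' j) ^ 2)) ≤ 1 + η := by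
  have hK : 0 < tensorKernel k a b (c, q) (c', q') := by
    unfold tensorKernel
    exact mul_pos hk (mehlerKernel_pos a b q q')
  have h := abs_le.1 (hnear (c, q) (c', q') hq hq')
  simp only [one_mul, mul_one] at h
  have hratio : (k c c' * mehlerKernel (A c c') (B c c') q q') / tensorKernel k a b (c, q) (c', q') =
      Real.exp (∑ j, ((a j - A c c' j) * (q j ^ 2 + q' j ^ 2) + (b j - B c c' j) * (q j - q' j) ^ 2)) := by
    unfold tensorKernel
    rw [mul_div_mul_left _ _ hk.ne', mehlerKernel_div_mehlerKernel]
  rw [← hratio]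
  constructor
  · rw [le_div_iff₀ hK]
    linarith [h.1]
  · rw [div_le_iff₀ hK]
    linarith [h.2]

/-- `x/(1+x) ≤ η` from `exp x ≤ 1 + η` or from `1 − η ≤ exp (−x)`, `x ≥ 0`. [folklore] -/
theorem div_one_add_le_of_exp_bounds {x η : ℝ} (hx : 0 ≤ x) (h : Real.exp x ≤ 1 + η ∨ 1 - η ≤ Real.exp (-x)) : x / (1 + x) ≤ η := by
  have h1x : 0 < 1 + x := by linarith
  have hle : x / (1 + x) ≤ x := by
    rw [div_le_iff₀ h1x]
    nlinarith
  rcases h with h | h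
  · have := Real.add_one_le_exp x
    linarith
  · -- `exp(−x) ≤ 1/(1+x)`
    have hexp : Real.exp (-x) ≤ 1 / (1 + x) := by
      rw [Real.exp_neg, one_div]
      exact inv_anti₀ h1x (by linarith [Real.add_one_le_exp x])
    have : 1 - 1 / (1 + x) = x / (1 + x) := by field_simp; ring
    linarith [this]

/-- ★ **FIRST-ORDER FLOOR on a stiff ball**: if the regional `hnear` holds on `S ∋ t·e_j` at a slow pair with `k(c,c') > 0`, then with `x = 2|a_j − A_j(c,c')|t²`,
`x/(1+x) ≤ η` — a first-order change of one stiff width, seen on a stiff ball of radius `t`, costs `η ≳ |ΔA_j|t²`. [cite: Luscher1983, §3] [cite: Helffer2013, Lemma 7.1] -/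
theorem width_floor_of_near_on [DecidableEq σ] {k : C → C → ℝ} {a b : σ → ℝ} {A B : C → C → σ → ℝ} {η : ℝ} {S : Set (σ → ℝ)}
    (hnear : ∀ x x' : C × (σ → ℝ), x.2 ∈ S → x'.2 ∈ S →
      |k x.1 x'.1 * mehlerKernel (A x.1 x'.1) (B x.1 x'.1) x.2 x'.2 - 1 * tensorKernel k a b x x'| ≤ η * 1 * tensorKernel k a b x x')
    {c c' : C} (hk : 0 < k c c') (j : σ) {t : ℝ} (ht : (Pi.single j t : σ → ℝ) ∈ S) :
    2 * |a j - A c c' j| * t ^ 2 / (1 + 2 * |a j - A c c' j| * t ^ 2) ≤ η := by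
  obtain ⟨h1, h2⟩ := exp_logRatio_bounds_of_near_on hnear hk ht ht
  rw [logRatio_single_single] at h1 h2
  have hx : 0 ≤ 2 * |a j - A c c' j| * t ^ 2 := by positivity
  refine div_one_add_le_of_exp_bounds hx ?_
  by_cases hA : 0 ≤ a j - A c c' j
  · left
    rwa [abs_of_nonneg hA]
  · right
    rw [abs_of_neg (lt_of_not_ge hA)]
    have e : -(2 * -(a j - A c c' j) * t ^ 2) = 2 * (a j - A c c' j) * t ^ 2 := by ring
    rwa [e]

/-- FLOOR from the time-zero test `q = t·e_j`, `q' = 0` (`S ∋ t·e_j, 0`): `x/(1+x) ≤ η` with `x = |a_j − A_j + b_j − B_j|t²`. [cite: Helffer2013, Lemma 7.1] -/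
theorem widthSum_floor_of_near_on [DecidableEq σ] {k : C → C → ℝ} {a b : σ → ℝ} {A B : C → C → σ → ℝ} {η : ℝ} {S : Set (σ → ℝ)}
    (hnear : ∀ x x' : C × (σ → ℝ), x.2 ∈ S → x'.2 ∈ S →
      |k x.1 x'.1 * mehlerKernel (A x.1 x'.1) (B x.1 x'.1) x.2 x'.2 - 1 * tensorKernel k a b x x'| ≤ η * 1 * tensorKernel k a b x x')
    {c c' : C} (hk : 0 < k c c') (j : σ) {t : ℝ} (ht : (Pi.single j t : σ → ℝ) ∈ S) (h0 : (0 : σ → ℝ) ∈ S) :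
    |a j - A c c' j + (b j - B c c' j)| * t ^ 2 / (1 + |a j - A c c' j + (b j - B c c' j)| * t ^ 2) ≤ η := by
  obtain ⟨h1, h2⟩ := exp_logRatio_bounds_of_near_on hnear hk ht h0
  rw [logRatio_single_zero] at h1 h2
  have hx : 0 ≤ |a j - A c c' j + (b j - B c c' j)| * t ^ 2 := by positivity
  refine div_one_add_le_of_exp_bounds hx ?_
  by_cases hA : 0 ≤ a j - A c c' j + (b j - B c c' j)
  · left
    rwa [abs_of_nonneg hA]
  · right
    rw [abs_of_neg (lt_of_not_ge hA)]
    have e : -(-(a j - A c c' j + (b j - B c c' j)) * t ^ 2) = (a j - A c c' j + (b j - B c c' j)) * t ^ 2 := by ring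
    rwa [e]

/-- No SECOND-order `η`: if `t·e_j ∈ S` and `η ≤ 1/2`, then `|a_j − A_j(c,c')|·t² ≤ η` (from `x/(1+x) ≤ η ≤ 1/2`: `x ≤ η/(1−η) ≤ 2η`, `x = 2|ΔA_j|t²`). [folklore] -/
theorem width_change_le_of_near_on [DecidableEq σ] {k : C → C → ℝ} {a b : σ → ℝ} {A B : C → C → σ → ℝ} {η : ℝ} {S : Set (σ → ℝ)}
    (hnear : ∀ x x' : C × (σ → ℝ), x.2 ∈ S → x'.2 ∈ S →
      |k x.1 x'.1 * mehlerKernel (A x.1 x'.1) (B x.1 x'.1) x.2 x'.2 - 1 * tensorKernel k a b x x'| ≤ η * 1 * tensorKernel k a b x x')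
    (hη : η ≤ 1 / 2) {c c' : C} (hk : 0 < k c c') (j : σ) {t : ℝ} (ht : (Pi.single j t : σ → ℝ) ∈ S) :
    |a j - A c c' j| * t ^ 2 ≤ η := by
  have h := width_floor_of_near_on hnear hk j ht
  set x := 2 * |a j - A c c' j| * t ^ 2 with hxdef
  have hx : 0 ≤ x := by positivity
  have h1x : 0 < 1 + x := by linarith
  rw [div_le_iff₀ h1x] at h
  -- `x ≤ η(1+x)`, `η ≤ 1/2` ⇒ `x/2 ≤ η`
  nlinarith

/-! ## §2 Achievability: the regional hypothesis holds at first order in the stiff-data change -/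

/-- The log-ratio form is bounded by `6|σ|δρ²` on the stiff box `|q_j|, |q'_j| ≤ ρ` when every width differs by at most `δ`. [folklore] -/
theorem abs_logRatio_le_on_box {a b a' b' : σ → ℝ} {δ ρ : ℝ} (hA : ∀ j, |a j - a' j| ≤ δ) (hB : ∀ j, |b j - b' j| ≤ δ)
    {q q' : σ → ℝ} (hq : ∀ j, |q j| ≤ ρ) (hq' : ∀ j, |q' j| ≤ ρ) :
    |∑ j, ((a j - a' j) * (q j ^ 2 + q' j ^ 2) + (b j - b' j) * (q j - q' j) ^ 2)| ≤ 6 * Fintype.card σ * δ * ρ ^ 2 := by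
  have hterm : ∀ j, |(a j - a' j) * (q j ^ 2 + q' j ^ 2) + (b j - b' j) * (q j - q' j) ^ 2| ≤ 6 * δ * ρ ^ 2 := by
    intro j
    have hδ : 0 ≤ δ := le_trans (abs_nonneg _) (hA j)
    have hq2 : q j ^ 2 ≤ ρ ^ 2 := by
      have := pow_le_pow_left₀ (abs_nonneg _) (hq j) 2
      rwa [sq_abs] at this
    have hq2' : q' j ^ 2 ≤ ρ ^ 2 := by
      have := pow_le_pow_left₀ (abs_nonneg _) (hq' j) 2
      rwa [sq_abs] at this
    have hd2 : (q j - q' j) ^ 2 ≤ 4 * ρ ^ 2 := by nlinarith [sq_nonneg (q j + q' j)]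
    have h1 : |(a j - a' j) * (q j ^ 2 + q' j ^ 2)| ≤ δ * (2 * ρ ^ 2) := by
      rw [abs_mul, abs_of_nonneg (by positivity : 0 ≤ q j ^ 2 + q' j ^ 2)]
      exact mul_le_mul (hA j) (by linarith) (by positivity) hδ
    have h2 : |(b j - b' j) * (q j - q' j) ^ 2| ≤ δ * (4 * ρ ^ 2) := by
      rw [abs_mul, abs_of_nonneg (sq_nonneg (q j - q' j))]
      exact mul_le_mul (hB j) hd2 (sq_nonneg _) hδ
    have := abs_add_le ((a j - a' j) * (q j ^ 2 + q' j ^ 2)) ((b j - b' j) * (q j - q' j) ^ 2)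
    linarith
  calc |∑ j, ((a j - a' j) * (q j ^ 2 + q' j ^ 2) + (b j - b' j) * (q j - q' j) ^ 2)|
      ≤ ∑ j, |(a j - a' j) * (q j ^ 2 + q' j ^ 2) + (b j - b' j) * (q j - q' j) ^ 2| := Finset.abs_sum_le_sum_abs _ _
    _ ≤ ∑ _j : σ, 6 * δ * ρ ^ 2 := Finset.sum_le_sum fun j _ => hterm j
    _ = 6 * Fintype.card σ * δ * ρ ^ 2 := by
      rw [Finset.sum_const, Finset.card_univ, nsmul_eq_mul]; ring

/-- ★ **ACHIEVABILITY of the regional hypothesis at first order**: widths within `δ` of the model's at every slow pair and coordinate, `k ≥ 0`, and the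
smallness `6|σ|δρ² ≤ 1` ⇒ on the stiff box `{q : ∀ j, |q_j| ≤ ρ}` the fibrewise-Mehler kernel is within the relative error `η = 12|σ|δρ²` (FIRST order in `δ`) of `k ⊗ K^{a,b}`.
[cite: Luscher1983, §3] [cite: Helffer2013, Lemma 7.1] -/
theorem near_on_box_of_stiffData_close {k : C → C → ℝ} {a b : σ → ℝ} {A B : C → C → σ → ℝ} {δ ρ : ℝ}
    (hk0 : ∀ c c', 0 ≤ k c c') (hA : ∀ c c' j, |a j - A c c' j| ≤ δ) (hB : ∀ c c' j, |b j - B c c' j| ≤ δ)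
    (h1 : 6 * Fintype.card σ * δ * ρ ^ 2 ≤ 1) :
    ∀ x x' : C × (σ → ℝ), (∀ j, |x.2 j| ≤ ρ) → (∀ j, |x'.2 j| ≤ ρ) →
      |k x.1 x'.1 * mehlerKernel (A x.1 x'.1) (B x.1 x'.1) x.2 x'.2 - 1 * tensorKernel k a b x x'| ≤
        12 * Fintype.card σ * δ * ρ ^ 2 * 1 * tensorKernel k a b x x' := by
  rintro ⟨c, q⟩ ⟨c', q'⟩ hq hq'
  simp only at hq hq' ⊢
  have hM : 0 < mehlerKernel a b q q' := mehlerKernel_pos a b q q'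
  have hK0 : 0 ≤ tensorKernel k a b (c, q) (c', q') := by
    unfold tensorKernel
    exact mul_nonneg (hk0 c c') hM.le
  -- `K₂ = K · exp Q`
  have hQ := mehlerKernel_div_mehlerKernel a b (A c c') (B c c') q q'
  set Q := ∑ j, ((a j - A c c' j) * (q j ^ 2 + q' j ^ 2) + (b j - B c c' j) * (q j - q' j) ^ 2) with hQdef
  have hK₂ : k c c' * mehlerKernel (A c c') (B c c') q q' = tensorKernel k a b (c, q) (c', q') * Real.exp Q := by
    unfold tensorKernel
    rw [← hQ, mul_assoc, mul_div_cancel₀ _ hM.ne']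
  rw [hK₂, one_mul, mul_one]
  have e : tensorKernel k a b (c, q) (c', q') * Real.exp Q - tensorKernel k a b (c, q) (c', q') =
      tensorKernel k a b (c, q) (c', q') * (Real.exp Q - 1) := by ring
  rw [e, abs_mul, abs_of_nonneg hK0, mul_comm]
  refine mul_le_mul_of_nonneg_right ?_ hK0
  have hQabs : |Q| ≤ 6 * Fintype.card σ * δ * ρ ^ 2 := abs_logRatio_le_on_box (hA c c') (hB c c') hq hq'
  have := Real.abs_exp_sub_one_le (x := Q) (hQabs.trans h1)
  linarith

end Summit.QuantumFields.YangMills.Theorems.TwistedTraceScaling.Negative.R21
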